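import Summits.ResolutionOfSingularities.ResolutionOfSingularities.Theorems.PicoverLocalModel.Negative.LoadBearing
import Summits.ResolutionOfSingularities.ResolutionOfSingularities.Theorems.PicoverLocalModel.Negative.FiniteTypeLoadBearing
import Literature.AlgebraicGeometry.Resolution.RegularLocalRingsNormal
import Mathlib.FieldTheory.KummerPolynomial

/-!
# Negative-side structure lemma for crux `PicoverLocalModel` (stmt-ResolutionOfSingularities-0557):
# the `p`-th-power dichotomy — `⧸ nilradical` only matters when `a` is a `p`-th power

Work file (cdisprove). For `R` a regular (hence normal) domain of characteristic `p` and `a ∈ R`: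
* either `a = b^p` for some `b ∈ R`, and then `(R[T]/(T^p - a))_red = R[T]/(T - b) ≅ R` — the model
  is `Spec R`, regular, its own resolution;
* or `a` is not a `p`-th power in `R`, equivalently (normality) not in `Frac R`, and then
  `T^p - a` is irreducible over `Frac R`, `R[T]/(T^p - a)` is an integral domain (free of rank `p`
  over `R`, embedded in the field `Frac(R)[T]/(T^p - a)`), already reduced: the model is
  `Spec R[T]/(T^p - a)` itself.
Hence the crux is equivalent to its "honest" form without `⧸ nilradical`, restricted to non-`p`-th
powers (`picoverLocalModel_iff_nonpower`).
-/

noncomputable section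

open CategoryTheory AlgebraicGeometry Polynomial
open Literature.AlgebraicGeometry.Resolution
open Summit.ResolutionOfSingularities.ResolutionOfSingularities.Theses.PAlteration

set_option linter.dupNamespace false

namespace Summit.ResolutionOfSingularities.ResolutionOfSingularities.Theorems.PicoverLocalModel.Negative

/-! ## Regular domains are normal -/

/-- A regular domain is integrally closed (Matsumura 19.4 at every maximal ideal). [folklore] -/
theorem isIntegrallyClosed_of_isRegularRing (R : Type*) [CommRing R] [IsDomain R] [IsRegularRing R] :
    IsIntegrallyClosed R := by
  refine IsIntegrallyClosed.of_localization_maximal fun m _ hm => ?_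
  haveI : IsRegularLocalRing (Localization.AtPrime m) :=
    IsRegularRing.isRegularLocalRing_localization m
  exact isIntegrallyClosed_of_isRegularLocalRing _

/-! ## Case `a = b^p`: the model is `Spec R` -/

section Power

variable (p : ℕ) [hp : Fact p.Prime] (R : Type) [CommRing R] [CharP R p]

omit [CharP R p] in
/-- `(R[T]/(T - b)^p)_red ≃ R` (evaluation at `b`; kernel `(T - b)` is the nilradical), for `R`
reduced. [folklore] -/
theorem nonempty_adjoinRoot_X_sub_C_pow_equiv [_root_.IsReduced R] (b : R) :
    Nonempty ((AdjoinRoot ((X - C b) ^ p) ⧸ nilradical (AdjoinRoot ((X - C b) ^ p))) ≃+* R) := by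
  let ev : AdjoinRoot ((X - C b : R[X]) ^ p) →+* R :=
    AdjoinRoot.lift (RingHom.id R) b (by
      rw [eval₂_pow, eval₂_sub, eval₂_X, eval₂_C, RingHom.id_apply, sub_self,
        zero_pow hp.out.ne_zero])
  have hsurj : Function.Surjective ev := fun r => ⟨AdjoinRoot.of _ r, by simp [ev]⟩
  have hroot : IsNilpotent (AdjoinRoot.root ((X - C b : R[X]) ^ p) - AdjoinRoot.of _ b) :=
    ⟨p, by rw [← AdjoinRoot.mk_X, ← AdjoinRoot.mk_C, ← map_sub, ← map_pow, AdjoinRoot.mk_self]⟩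
  have hker : RingHom.ker ev = nilradical (AdjoinRoot ((X - C b : R[X]) ^ p)) := by
    apply le_antisymm
    · intro x hx
      rw [RingHom.mem_ker] at hx
      rw [mem_nilradical]
      induction x using AdjoinRoot.induction_on with
      | ih q =>
        have hq : q %ₘ (X - C b) + (X - C b) * (q /ₘ (X - C b)) = q := modByMonic_add_div q _
        rw [modByMonic_X_sub_C_eq_C_eval] at hq
        have h0 : q.eval b = 0 := by
          simpa [ev, AdjoinRoot.lift_mk, eval₂_id] using hx
        have hq' : q = (X - C b) * (q /ₘ (X - C b)) := by
          conv_lhs => rw [← hq, h0, map_zero, zero_add]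
        rw [hq', map_mul, map_sub, AdjoinRoot.mk_X, AdjoinRoot.mk_C]
        exact Commute.isNilpotent_mul_right (Commute.all _ _) hroot
    · intro x hx
      rw [mem_nilradical] at hx
      obtain ⟨n, hn⟩ := hx
      rw [RingHom.mem_ker]
      have : (ev x) ^ n = 0 := by rw [← map_pow, hn, map_zero]
      exact IsReduced.eq_zero _ ⟨n, this⟩
  exact ⟨(Ideal.quotEquivOfEq hker.symm).trans (RingHom.quotientKerEquivOfSurjective hsurj)⟩

/-- In characteristic `p`, `T^p - b^p = (T - b)^p`. [folklore] -/
theorem X_pow_sub_C_pow_eq (b : R) : (X : R[X]) ^ p - C (b ^ p) = (X - C b) ^ p := by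
  rw [sub_pow_char, map_pow]

/-- **Case `a = b^p`: `(R[T]/(T^p - b^p))_red ≃ R`** for `R` reduced of characteristic `p`.
[folklore] -/
theorem nonempty_localModelRing_pow_equiv [_root_.IsReduced R] (b : R) :
    Nonempty ((AdjoinRoot (X ^ p - C (b ^ p)) ⧸ nilradical (AdjoinRoot (X ^ p - C (b ^ p))))
      ≃+* R) := by
  obtain ⟨e⟩ := nonempty_adjoinRoot_X_sub_C_pow_equiv p R b
  -- transport along the equality of polynomials
  have h := X_pow_sub_C_pow_eq p R b
  let e₁ : AdjoinRoot ((X : R[X]) ^ p - C (b ^ p)) ≃+* AdjoinRoot ((X - C b : R[X]) ^ p) :=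
    (Ideal.quotientEquivAlgOfEq R (by rw [h])).toRingEquiv
  have hnil : nilradical (AdjoinRoot ((X - C b : R[X]) ^ p)) =
      (nilradical (AdjoinRoot ((X : R[X]) ^ p - C (b ^ p)))).map e₁.toRingHom := by
    ext y
    rw [RingEquiv.toRingHom_eq_coe, Ideal.map_comap_of_equiv, Ideal.mem_comap, mem_nilradical,
      mem_nilradical]
    constructor
    · intro hy
      exact hy.map _
    · intro hy
      simpa using hy.map e₁
  exact ⟨(Ideal.quotientEquiv _ _ e₁ hnil).trans e⟩

/-- **Case `a = b^p` for the crux**: the model has a resolution iff `Spec R` has one; in particular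
it has one when `R` is regular. [folklore] -/
theorem hasResolution_localModel_pow [_root_.IsReduced R] [IsRegularRing R] (b : R) :
    Scheme.HasResolution
      (Spec (.of (AdjoinRoot (X ^ p - C (b ^ p)) ⧸ nilradical (AdjoinRoot (X ^ p - C (b ^ p)))))) := by
  obtain ⟨e⟩ := nonempty_localModelRing_pow_equiv p R b
  refine Scheme.HasResolution.of_iso (Spec.map e.toCommRingCatIso.hom) ?_
  refine Scheme.IsRegular.hasResolution fun x => ?_
  haveI : IsRegularLocalRing (Localization.AtPrime x.asIdeal) :=
    IsRegularRing.isRegularLocalRing_localization x.asIdeal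
  exact IsRegularLocalRing.of_ringEquiv (Spec.stalkIso (.of R) x).commRingCatIsoToRingEquiv.symm

end Power

/-! ## Case `a ∉ R^p`: the model is the integral domain `R[T]/(T^p - a)` -/

section NonPower

variable (p : ℕ) [hp : Fact p.Prime] (R : Type) [CommRing R] [IsDomain R] [IsIntegrallyClosed R]

omit [IsDomain R] in
/-- Over a normal domain, an element which is not a `p`-th power in `R` is not a `p`-th power in
`Frac R`. [folklore] -/
theorem not_pow_fractionRing {a : R} (ha : ∀ b : R, b ^ p ≠ a) (c : FractionRing R) :
    c ^ p ≠ algebraMap R (FractionRing R) a := by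
  intro hc
  obtain ⟨b, hb⟩ := IsIntegrallyClosed.exists_algebraMap_eq_of_isIntegral_pow (R := R)
    (K := FractionRing R) hp.out.pos (hc ▸ isIntegral_algebraMap)
  apply ha b
  apply IsFractionRing.injective R (FractionRing R)
  rw [map_pow, hb, hc]

/-- **Case `a ∉ R^p`: `R[T]/(T^p - a)` is an integral domain** (`R` a normal domain): it embeds in
the field `Frac(R)[T]/(T^p - a)`, `T^p - a` being irreducible over `Frac R`. [folklore] -/
theorem isDomain_adjoinRoot_of_not_pow {a : R} (ha : ∀ b : R, b ^ p ≠ a) :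
    IsDomain (AdjoinRoot ((X : R[X]) ^ p - C a)) := by
  set K := FractionRing R
  have hirr : Irreducible ((X : K[X]) ^ p - C (algebraMap R K a)) :=
    X_pow_sub_C_irreducible_of_prime hp.out (not_pow_fractionRing p R ha)
  haveI : Fact (Irreducible ((X : K[X]) ^ p - C (algebraMap R K a))) := ⟨hirr⟩
  set F := AdjoinRoot ((X : K[X]) ^ p - C (algebraMap R K a))
  have hy : ((X : R[X]) ^ p - C a).eval₂ (Algebra.ofId R F : R →+* F) (AdjoinRoot.root _) = 0 := by
    have := AdjoinRoot.eval₂_root ((X : K[X]) ^ p - C (algebraMap R K a))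
    rw [eval₂_sub, eval₂_X_pow, eval₂_C] at this ⊢
    rw [sub_eq_zero] at this ⊢
    rw [this]
    rfl
  have hmin : (minpoly K (AdjoinRoot.root ((X : K[X]) ^ p - C (algebraMap R K a)))).degree =
      ((X : R[X]) ^ p - C a).degree := by
    rw [AdjoinRoot.minpoly_root hirr.ne_zero, degree_mul, degree_C (inv_ne_zero (by
      rw [(monic_X_pow_sub_C _ hp.out.ne_zero).leadingCoeff]; exact one_ne_zero)), add_zero,
      degree_X_pow_sub_C hp.out.pos, degree_X_pow_sub_C hp.out.pos]
  have hinj := liftAlgHom_injective (K := K) (monic_X_pow_sub_C a hp.out.ne_zero) _ hy hmin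
  exact Function.Injective.isDomain _ hinj

/-- … hence already reduced: the reduced model is `R[T]/(T^p - a)` itself. [folklore] -/
theorem nonempty_localModelRing_equiv_of_not_pow {a : R} (ha : ∀ b : R, b ^ p ≠ a) :
    Nonempty ((AdjoinRoot (X ^ p - C a) ⧸ nilradical (AdjoinRoot (X ^ p - C a))) ≃+*
      AdjoinRoot ((X : R[X]) ^ p - C a)) := by
  haveI := isDomain_adjoinRoot_of_not_pow p R ha
  exact ⟨(Ideal.quotEquivOfEq (nilradical_eq_zero _)).trans (RingEquiv.quotientBot _)⟩

end NonPower

/-! ## The crux without `⧸ nilradical`, restricted to non-`p`-th powers -/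

/-- **The `p`-th-power dichotomy makes the reduction cosmetic**: the crux is equivalent to
"for `R` a regular finitely generated `k`-domain (char `p`) and `a ∈ R ∖ R^p`, the integral affine
scheme `Spec R[T]/(T^p - a)` has a resolution". [folklore] -/
theorem picoverLocalModel_iff_nonpower :
    PicoverLocalModel ↔ ∀ p : ℕ, p.Prime → ∀ (k : Type) [Field k] [CharP k p] (R : Type)
      [CommRing R] [IsDomain R] [Algebra k R], Algebra.FiniteType k R → IsRegularRing R →
        ∀ a : R, (∀ b : R, b ^ p ≠ a) →
          Scheme.HasResolution (Spec (.of (AdjoinRoot ((X : R[X]) ^ p - C a)))) := by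
  constructor
  · intro h p hp k _ _ R _ _ _ hft hreg a ha
    haveI : Fact p.Prime := ⟨hp⟩
    haveI : IsIntegrallyClosed R := isIntegrallyClosed_of_isRegularRing R
    obtain ⟨e⟩ := nonempty_localModelRing_equiv_of_not_pow p R ha
    exact (h p hp k R hft hreg a).of_iso (Spec.map e.symm.toCommRingCatIso.hom)
  · intro h p hp k _ _ R _ _ _ hft hreg a
    haveI : Fact p.Prime := ⟨hp⟩
    haveI : CharP R p := by
      haveI : Nontrivial R := inferInstance
      exact charP_of_injective_algebraMap (algebraMap k R).injective p
    by_cases ha : ∃ b : R, b ^ p = a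
    · obtain ⟨b, rfl⟩ := ha
      exact hasResolution_localModel_pow p R b
    · simp only [not_exists] at ha
      haveI : IsIntegrallyClosed R := isIntegrallyClosed_of_isRegularRing R
      obtain ⟨e⟩ := nonempty_localModelRing_equiv_of_not_pow p R ha
      exact (h p hp k R hft hreg a ha).of_iso (Spec.map e.toCommRingCatIso.hom)

end Summit.ResolutionOfSingularities.ResolutionOfSingularities.Theorems.PicoverLocalModel.Negative

end
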